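import Literature.NumberTheory.EllipticCurves.ModularDegreeFormulaProofs
import Literature.NumberTheory.EllipticCurves.Pal2012.QuadraticTwistPeriodProofs
import Literature.NumberTheory.EllipticCurves.ComplexPeriodProofs
import Literature.NumberTheory.EllipticCurves.CongruenceNumber
import Literature.NumberTheory.DiophantineGeometry.LocalReduction
import HarnessLib

/-!
# The period-product identity behind Jetchev–Skinner–Wan 2017, (7.3.2) "(eq:period product)":
# `deg φ · √|d| · Ω(E) · Ω(E^d) = 8π² c_E² c_∞(E^d) · (f, f)` — PROVED from Zagier 1985 and Pal 2012

A proofs-only leaf (theorems only: no definition, no named fact; D-0026), written for the ARM P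
referee-reader audit of `JetchevSkinnerWan2017.thm121_padicValRat_bsd_rank_one` (cell `pub/bsd-cited`,
sheet `sheets/D-AUDIT-r15.md` + ADDENDUM-4, status item S1).

## What is proved, and why

D. Jetchev, C. Skinner, X. Wan, *The Birch and Swinnerton-Dyer formula for elliptic curves of analytic
rank one*, Camb. J. Math. **5** (2017) 369–434 (= arXiv:1512.06894), §7.3.2, pass from W. Zhang's
Gross–Zagier formula on `X_{N⁺,N⁻}` (stated with the congruence period
`Ω_f^cong = ⟨f, f⟩/η_f`, `⟨f, f⟩ = 8π² ∬_{Γ₀(N)∖ℍ} |f|² dx dy`, `η_f` the congruence number) to the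
BSD periods by the relation

  (eq:period product)   `Ω_f^cong = √|D| · Ω_E · Ω_{E^D}`   up to a `p`-adic unit,

which they derive from three inputs: `Ω_E = −2πi Ω_f⁺` (Skinner 2016 / Greenberg–Vatsal 2000),
`Ω_f^cong = i(2π)² Ω_f⁺ Ω_f⁻` and `Ω_f^± = √(−D) Ω_{f_K}^∓` — the last two being Lemmas 9.5 / 9.6 of
the UNPUBLISHED preprint C. Skinner, W. Zhang, arXiv:1407.1099 (2014). This file proves, in the tree's
vocabulary and WITHOUT canonical periods `Ω_f^±`, the exact archimedean identity from which
(eq:period product) follows by refereed inputs only: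

* `ModularParametrizationData.deg_mul_realPeriodRat_mul_imaginaryPeriodRat`: for a parametrisation
  datum `D = (f, Λ_E, φ, c, deg φ)` of `W/ℚ`, `deg φ · Ω(W) · |Ω⁻(W)| = 8π² c² (f, f)` — Zagier's formula
  `4π² c² (f,f) = deg φ · covol(Λ_E)` (Canad. Math. Bull. 28 (1985) §1, PROVED in the tree:
  `zagier_degree_formula_holds`) with `Ω · |Ω⁻| = ∬_{E(ℂ)}|ω ∧ ω̄| = 2 covol(Λ_E)` (Cremona §3.7;
  tree `realPeriodRat_mul_imaginaryPeriodRat`, `complexPeriod_eq_two_mul_covolume'`);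
* `ModularParametrizationData.deg_mul_sqrt_mul_realPeriodRat_mul_realPeriodRat_twist`: for `W`
  globally minimal, `d < 0` square-free with `d ≡ 1 (mod 4)`, `W` good or multiplicative at the primes
  dividing `d`, and `Wd` any globally minimal model of the twist `W^{(d)}`:
  `deg φ · √(−d) · Ω(W) · Ω(Wd) = 8π² c² c_∞(Wd) (f, f)` — the previous identity with V. Pal, Proc. AMS
  140 (2012) Thm. 3.2 / Prop. 2.5 (`Ω(E^d) √(−d) = ũ c_∞(E^d) |Ω⁻(E)|`, `ũ = 1` here; PROVED in the tree:
  `realPeriodRat_mul_sqrt_eq_of_twist_of_neg_of_squarefree`); the semistable form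
  `…_of_isSemistable` (every `v`: good or multiplicative) is JSW's setting (`N` square-free);
* `…eight_pi_sq_mul_peterssonProduct_re_div_congruenceNumber_eq`: the same identity solved for the
  congruence period in the tree's normalisation, `8π² (f,f) / r_f = u · √(−d) Ω(W) Ω(Wd)` with the
  EXPLICIT rational factor `u = deg φ / (r_f · c² · c_∞(Wd))`, `r_f = congruenceNumber f` (ARS 2012 §2.1;
  tree `CongruenceNumber.lean`);
* `…padicValRat_periodProductFactor_eq_zero`: `ord_p u = 0` for an odd prime `p` with
  `ord_p(r_f) = ord_p(deg φ)` and `p ∤ c` — the first is Agashe–Ribet–Stein, *The modular degree,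
  congruence primes, and multiplicity one* (Springer 2012) Thm. 2.1 at `ord_p(N) ≤ 1` (tree named fact
  `padicValNat_congruenceNumber_eq_of_not_sq_dvd`, fed by name in `…_of_ARS`; Abbes–Ullmo, Compositio
  103 (1996) Prop. 3.3–3.4 at `p ∤ N`), the second is Mazur, Invent. Math. 44 (1978) Cor. 4.1
  (`p ∣ c ⇒ p² ∣ 4N`; JSW Remark 7.3.3 = arXiv Rem. 43) — so that for semistable optimal `E`, odd good `p`
  and `K = ℚ(√d)`: `⟨f,f⟩/η_f ≐_p √|d| Ω_E Ω_{E^d}`, which is (eq:period product) (JSW's `√|D|`,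
  `D ∈ {d, 4d}`, differs by a power of `2`; JSW's `η_f` is the `𝔪`-local generator of
  `π_f(Ann_𝕋 ker π_f) ⊗ ℤ_p`, Skinner–Zhang §9.3, whose `p`-adic valuation is that of ARS's `r_E`
  by ARS 2012 Lemmas 4.3–4.4 — recorded in the audit sheet, not used by the theorems below).

Nothing here is specific to JSW: it is the classical bookkeeping `‖ω‖² = 2 covol(Λ_E)` of
Gross–Zagier 1986 p. 311 combined with Zagier's and Pal's theorems. No Skinner–Zhang lemma, no
canonical period of `f`, and no hypothesis `(D, N) = 1` is used (Pal's `u_ℓ = 1` at a multiplicative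
`ℓ ∣ d`), so the identity also covers JSW's auxiliary field `K'` ramified at a prime `q ∣ N`.

## References
* [JetchevSkinnerWan2017] D. Jetchev, C. Skinner, X. Wan, Camb. J. Math. 5 (2017), §7.3.2
  (eq:omegaE=omegaf), (eq:congperiod), (eq:period of twist), (eq:period product); §7.4.1 display before
  (eq:gz for K').
* [ZagierCMB1985] D. Zagier, Canad. Math. Bull. 28 (1985), §1 p. 374.
* [Pal2012] V. Pal, Proc. Amer. Math. Soc. 140 (2012) 1513–1525, Prop. 2.5, Cor. 2.6, Thm. 3.2, p. 1514.
* [AgasheRibetStein2012] A. Agashe, K. Ribet, W. Stein, in *Number Theory, Analysis and Geometry*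
  (Springer, 2012) 19–49, Thm. 2.1, Def. 3.5, Lemmas 4.3–4.4.
* [CremonaAlgorithms1997] J. E. Cremona, *Algorithms for modular elliptic curves*, 2nd ed., §2.10, §3.7.
* B. Mazur, Invent. Math. 44 (1978), Cor. 4.1; A. Abbes, E. Ullmo, Compositio Math. 103 (1996) Thm. A,
  Prop. 3.3–3.4; C. Skinner, W. Zhang, arXiv:1407.1099, Lemmas 9.5/9.6 (the bypassed inputs).
-/

noncomputable section

open scoped MatrixGroups ModularForm Classical NumberField

open CongruenceSubgroup Complex NumberField IsDedekindDomain IsDedekindDomain.HeightOneSpectrum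
  Rat.HeightOneSpectrum WeierstrassCurve

namespace Literature.NumberTheory.EllipticCurves.ModularForms.ModularParametrizationData

variable {W : WeierstrassCurve ℚ} [W.IsElliptic] {N : ℕ} [NeZero N]
  (D : ModularParametrizationData W N)

/-! ### The Néron covolume of the datum and the periods of the model -/

omit [W.IsElliptic] in
/-- Base change `ℚ → ℝ → ℂ` is base change `ℚ → ℂ` (ring homomorphisms out of `ℚ` are unique). [folklore] -/
private theorem baseChange_real_map_complex :
    (W.baseChange ℝ).map (algebraMap ℝ ℂ) = W.baseChange ℂ := by
  rw [WeierstrassCurve.baseChange, WeierstrassCurve.baseChange, WeierstrassCurve.map_map]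
  congr 1

omit [W.IsElliptic] in
/-- `2 · covol(Λ_D) = ∬_{E(ℂ)} |ω ∧ ω̄|` (`complexPeriod` of `W ⊗ ℂ`): the lattice of the datum is a
period lattice of the model `W` (`g₂ = c₄/12`, `g₃ = c₆/216`), and the period lattice is unique
(`complexPeriod_eq_two_mul_covolume'`). [cite: CremonaAlgorithms1997, §3.7] -/
theorem two_mul_covolume_eq_complexPeriod :
    2 * ZLattice.covolume D.L.lattice = (W.baseChange ℂ).complexPeriod := by
  obtain ⟨h₂, h₃⟩ := D.isNeronLattice
  exact ((W.baseChange ℂ).complexPeriod_eq_two_mul_covolume' h₂ h₃).symm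

/-- **`Ω(W) · |Ω⁻(W)| = 2 · covol(Λ_D)`**: real period (all real components) times imaginary period of
the model `W` is twice the covolume of the datum's lattice (Cremona §3.7: rectangular `c_∞ = 2`,
`covol = Ω₀|Ω⁻|`; rhombic `c_∞ = 1`, `covol = Ω₀|Ω⁻|/2`). [cite: CremonaAlgorithms1997, §3.7] -/
theorem realPeriodRat_mul_imaginaryPeriodRat_eq_two_mul_covolume :
    W.realPeriodRat * W.imaginaryPeriodRat = 2 * ZLattice.covolume D.L.lattice := by
  rw [W.realPeriodRat_mul_imaginaryPeriodRat, baseChange_real_map_complex,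
    D.two_mul_covolume_eq_complexPeriod]

/-! ### Zagier's formula in period form -/

/-- **`deg φ · Ω(W) · |Ω⁻(W)| = 8π² c² (f, f)`** — Zagier's degree formula
`4π² c² (f, f) = deg φ · covol(Λ_E)` (PROVED in the tree, `zagier_degree_formula_holds`) with
`Ω · |Ω⁻| = 2 covol`. Here `(f, f) = peterssonProduct (Γ₀(N)) 2 f f = ∬_{Γ₀(N)∖ℍ}|f|² dx dy` (real),
so `8π² (f, f)` is the Petersson norm `⟨f, f⟩` in the normalisation of Skinner–Zhang 2014 §9.3 /
W. Zhang 2014 (6.3) / JSW 2017 §7.3.2. [cite: ZagierCMB1985, §1 (p. 374)] -/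
theorem deg_mul_realPeriodRat_mul_imaginaryPeriodRat :
    (D.deg : ℝ) * (W.realPeriodRat * W.imaginaryPeriodRat) =
      8 * Real.pi ^ 2 * (D.c : ℝ) ^ 2 * (peterssonProduct (Gamma0 N) 2 D.f D.f).re := by
  have h := congrArg Complex.re D.zagier_degree_formula_holds
  rw [Complex.re_ofReal_mul, Complex.ofReal_re] at h
  -- `h : 4π² c² · Re(f,f) = deg · covol`
  rw [D.realPeriodRat_mul_imaginaryPeriodRat_eq_two_mul_covolume, mul_left_comm, ← h]
  ring

/-! ### With Pal's theorem: the period product of `E` and `E^d` -/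

/-- **The period-product identity** (JSW 2017 (eq:period product), exact form):
for `W/ℚ` globally minimal, `d < 0` square-free with `d ≡ 1 (mod 4)`, `W` good or multiplicative at every
prime dividing `d`, and `Wd` any globally minimal model of the quadratic twist `W^{(d)}`
(`C • W.quadraticTwist d = Wd`):
`deg φ · √(−d) · Ω(W) · Ω(Wd) = 8π² c² · c_∞(Wd) · (f, f)`, where `Ω = realPeriodRat` (all real
components), `c_∞(Wd)` the number of real components of `Wd`, `c` the Manin constant and `deg φ` the
degree of the datum. Zagier 1985 + Pal 2012 Thm. 3.2 (`ũ = 1`), both proved in the tree.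
[cite: Pal2012, Thm. 3.2 (case d < 0) with Prop. 2.5] [cite: ZagierCMB1985, §1 (p. 374)] -/
theorem deg_mul_sqrt_mul_realPeriodRat_mul_realPeriodRat_twist [W.IsGloballyMinimal] {d : ℤ}
    (hd : d < 0) (hd4 : d % 4 = 1) (hsq : Squarefree d)
    (hV : ∀ v : HeightOneSpectrum (𝓞 ℚ), ((primesEquiv v : ℕ) : ℤ) ∣ d →
      W.HasGoodReductionAt v ∨ W.HasMultiplicativeReductionAt v)
    (Wd : WeierstrassCurve ℚ) [Wd.IsGloballyMinimal] (C : VariableChange ℚ)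
    (hC : C • W.quadraticTwist (d : ℚ) = Wd) :
    (D.deg : ℝ) * Real.sqrt (-(d : ℝ)) * W.realPeriodRat * Wd.realPeriodRat =
      8 * Real.pi ^ 2 * (D.c : ℝ) ^ 2 * (Wd.baseChange ℝ).numRealComponents *
        (peterssonProduct (Gamma0 N) 2 D.f D.f).re := by
  have hPal := W.realPeriodRat_mul_sqrt_eq_of_twist_of_neg_of_squarefree hd hd4 hsq hV Wd C hC
  have hZ := D.deg_mul_realPeriodRat_mul_imaginaryPeriodRat
  calc (D.deg : ℝ) * Real.sqrt (-(d : ℝ)) * W.realPeriodRat * Wd.realPeriodRat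
        = D.deg * W.realPeriodRat * (Wd.realPeriodRat * Real.sqrt (-(d : ℝ))) := by ring
    _ = D.deg * W.realPeriodRat * ((Wd.baseChange ℝ).numRealComponents * W.imaginaryPeriodRat) := by
          rw [hPal]
    _ = (Wd.baseChange ℝ).numRealComponents * (D.deg * (W.realPeriodRat * W.imaginaryPeriodRat)) := by
          ring
    _ = 8 * Real.pi ^ 2 * (D.c : ℝ) ^ 2 * (Wd.baseChange ℝ).numRealComponents *
          (peterssonProduct (Gamma0 N) 2 D.f D.f).re := by rw [hZ]; ring

/-- The period-product identity for a SEMISTABLE curve (JSW's standing hypothesis: `N` square-free —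
good or multiplicative reduction at every finite place, `WeierstrassCurve.IsSemistable (𝓞 ℚ)`), for
every square-free `d < 0` with `d ≡ 1 (mod 4)`: no coprimality of `d` and `N` is needed (Pal's
`u_ℓ = 1` at a multiplicative `ℓ ∣ d`). [cite: Pal2012, Thm. 3.2 (case d < 0) with Prop. 2.5] -/
theorem deg_mul_sqrt_mul_realPeriodRat_mul_realPeriodRat_twist_of_isSemistable [W.IsGloballyMinimal]
    (hsst : W.IsSemistable (𝓞 ℚ)) {d : ℤ} (hd : d < 0) (hd4 : d % 4 = 1) (hsq : Squarefree d)
    (Wd : WeierstrassCurve ℚ) [Wd.IsGloballyMinimal] (C : VariableChange ℚ)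
    (hC : C • W.quadraticTwist (d : ℚ) = Wd) :
    (D.deg : ℝ) * Real.sqrt (-(d : ℝ)) * W.realPeriodRat * Wd.realPeriodRat =
      8 * Real.pi ^ 2 * (D.c : ℝ) ^ 2 * (Wd.baseChange ℝ).numRealComponents *
        (peterssonProduct (Gamma0 N) 2 D.f D.f).re :=
  D.deg_mul_sqrt_mul_realPeriodRat_mul_realPeriodRat_twist hd hd4 hsq (fun v _ => hsst v) Wd C hC

/-! ### The congruence period `8π²(f,f)/r_f` and its rational factor -/

/-- **The congruence period as a rational multiple of `√(−d) Ω(W) Ω(Wd)`.** In the situation of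
`deg_mul_sqrt_mul_realPeriodRat_mul_realPeriodRat_twist`, with `r_f = congruenceNumber f`
(Agashe–Ribet–Stein 2012 §2.1) assumed non-zero:
`8π² (f, f) / r_f = u · (√(−d) · Ω(W) · Ω(Wd))` with `u = deg φ / (r_f · c² · c_∞(Wd)) ∈ ℚ`.
(`8π²(f,f)/r_f` is `Ω_f^cong = ⟨f,f⟩/η_f` of JSW §7.3.2 in the tree's normalisation; the theorem is
the exact form of JSW's (eq:period product), the `p`-adic valuation of `u` being computed in
`padicValRat_periodProductFactor_eq_zero`.) [cite: JetchevSkinnerWan2017, §7.3.2 (eq:period product)]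
[cite: AgasheRibetStein2012, §2.1 and Def. 3.5] -/
theorem eight_pi_sq_mul_peterssonProduct_re_div_congruenceNumber_eq [W.IsGloballyMinimal] {d : ℤ}
    (hd : d < 0) (hd4 : d % 4 = 1) (hsq : Squarefree d)
    (hV : ∀ v : HeightOneSpectrum (𝓞 ℚ), ((primesEquiv v : ℕ) : ℤ) ∣ d →
      W.HasGoodReductionAt v ∨ W.HasMultiplicativeReductionAt v)
    (Wd : WeierstrassCurve ℚ) [Wd.IsGloballyMinimal] (C : VariableChange ℚ)
    (hC : C • W.quadraticTwist (d : ℚ) = Wd) (hr : congruenceNumber D.f ≠ 0) :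
    8 * Real.pi ^ 2 * (peterssonProduct (Gamma0 N) 2 D.f D.f).re / congruenceNumber D.f =
      (((D.deg : ℚ) / (congruenceNumber D.f * D.c ^ 2 * (Wd.baseChange ℝ).numRealComponents) : ℚ) : ℝ) *
        (Real.sqrt (-(d : ℝ)) * W.realPeriodRat * Wd.realPeriodRat) := by
  have key := D.deg_mul_sqrt_mul_realPeriodRat_mul_realPeriodRat_twist hd hd4 hsq hV Wd C hC
  have hc0 : D.maninConstant ≠ 0 := D.maninConstant_ne_zero_holds
  have hc : (D.c : ℝ) ≠ 0 := by exact_mod_cast hc0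
  have hn : (0 : ℝ) < (Wd.baseChange ℝ).numRealComponents := by
    exact_mod_cast (Wd.baseChange ℝ).numRealComponents_pos
  have hrR : (congruenceNumber D.f : ℝ) ≠ 0 := by exact_mod_cast hr
  have hcast : ((((D.deg : ℚ) / (congruenceNumber D.f * D.c ^ 2 * (Wd.baseChange ℝ).numRealComponents)
      : ℚ) : ℝ)) = (D.deg : ℝ) / (congruenceNumber D.f * (D.c : ℝ) ^ 2 * (Wd.baseChange ℝ).numRealComponents) := by
    push_cast; ring
  rw [hcast, div_mul_eq_mul_div,
    show (D.deg : ℝ) * (Real.sqrt (-(d : ℝ)) * W.realPeriodRat * Wd.realPeriodRat) =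
      (D.deg : ℝ) * Real.sqrt (-(d : ℝ)) * W.realPeriodRat * Wd.realPeriodRat by ring, key,
    div_eq_div_iff hrR (mul_ne_zero (mul_ne_zero hrR (pow_ne_zero 2 hc)) hn.ne')]
  ring

/-- **`ord_p u = 0`** for the rational factor `u = deg φ / (r_f · c² · c_∞)` of
`eight_pi_sq_mul_peterssonProduct_re_div_congruenceNumber_eq` at an ODD prime `p` with
`ord_p(r_f) = ord_p(deg φ)` (Agashe–Ribet–Stein 2012 Thm. 2.1 when `ord_p(N) ≤ 1`; Abbes–Ullmo 1996
when `p ∤ N`) and `p ∤ c` (Mazur 1978 Cor. 4.1: `p ∣ c ⇒ p² ∣ 4N`): then `u` is a `p`-adic unit, i.e.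
JSW's "(eq:period product) holds up to a `p`-adic unit". Pure arithmetic (`c_∞ ∈ {1, 2}`).
[cite: AgasheRibetStein2012, Thm. 2.1] [cite: JetchevSkinnerWan2017, §7.3.2 Remark 7.3.3 (Mazur)] -/
theorem padicValRat_periodProductFactor_eq_zero {p : ℕ} [Fact p.Prime] (hp2 : p ≠ 2)
    {deg r : ℕ} {c : ℤ} {n : ℕ} (hdeg : 0 < deg) (hr : r ≠ 0) (hc : ¬ (p : ℤ) ∣ c)
    (hn : n = 1 ∨ n = 2) (hval : padicValNat p r = padicValNat p deg) :
    padicValRat p ((deg : ℚ) / (r * c ^ 2 * n)) = 0 := by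
  have hp : p.Prime := Fact.out
  have hc0 : c ≠ 0 := by rintro rfl; exact hc (dvd_zero _)
  have hn0 : n ≠ 0 := by rcases hn with rfl | rfl <;> decide
  have hdegQ : (deg : ℚ) ≠ 0 := by exact_mod_cast hdeg.ne'
  have hrQ : (r : ℚ) ≠ 0 := by exact_mod_cast hr
  have hcQ : (c : ℚ) ≠ 0 := by exact_mod_cast hc0
  have hnQ : (n : ℚ) ≠ 0 := by exact_mod_cast hn0
  have hvc : padicValRat p (c : ℚ) = 0 := by
    rw [padicValRat.of_int]
    exact_mod_cast padicValInt.eq_zero_of_not_dvd hc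
  have hvn : padicValRat p (n : ℚ) = 0 := by
    rw [padicValRat.of_nat]
    rcases hn with rfl | rfl
    · simp
    · have : ¬ p ∣ 2 := fun h => hp2 ((Nat.prime_dvd_prime_iff_eq hp Nat.prime_two).mp h)
      exact_mod_cast padicValNat.eq_zero_of_not_dvd this
  have hc2 : padicValRat p ((c : ℚ) ^ 2) = 0 := by
    rw [pow_two, padicValRat.mul hcQ hcQ, hvc, add_zero]
  rw [padicValRat.div hdegQ (mul_ne_zero (mul_ne_zero hrQ (pow_ne_zero 2 hcQ)) hnQ),
    padicValRat.mul (mul_ne_zero hrQ (pow_ne_zero 2 hcQ)) hnQ,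
    padicValRat.mul hrQ (pow_ne_zero 2 hcQ), hc2, hvn, padicValRat.of_nat, padicValRat.of_nat, hval]
  ring

/-- **(eq:period product) up to a `p`-adic unit, fed by the tree's named facts BY NAME.** For a
parametrisation datum `D` of MINIMAL degree among the data with the same newform at level `N` (`W` the
`X₀(N)`-optimal curve, `φ_D` its optimal parametrisation — the reduction JSW make at the start of §7),
an odd prime `p` with `p² ∤ N` and `p ∤ c`, and `(W, d, Wd)` as in
`eight_pi_sq_mul_peterssonProduct_re_div_congruenceNumber_eq`: the rational factor `u` relating the
congruence period `8π²(f,f)/r_f` to `√(−d) Ω(W) Ω(Wd)` is a `p`-adic unit, GIVEN Agashe–Ribet–Stein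
2012 Thm. 2.1 (`padicValNat_congruenceNumber_eq_of_not_sq_dvd`, a named fact of the tree taken as the
hypothesis `hARS`). [cite: AgasheRibetStein2012, Thm. 2.1] [cite: JetchevSkinnerWan2017, §7.3.2 (eq:period product)] -/
theorem exists_rat_padicValRat_eq_zero_congruencePeriod_eq_of_ARS
    (hARS : padicValNat_congruenceNumber_eq_of_not_sq_dvd) [W.IsGloballyMinimal]
    (hopt : ∀ (W' : WeierstrassCurve ℚ) [W'.IsElliptic] (D' : ModularParametrizationData W' N),
      D'.f = D.f → D.modularDegree ≤ D'.modularDegree)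
    {p : ℕ} [Fact p.Prime] (hp2 : p ≠ 2) (hpN : ¬ p ^ 2 ∣ N) (hpc : ¬ (p : ℤ) ∣ D.c)
    {d : ℤ} (hd : d < 0) (hd4 : d % 4 = 1) (hsq : Squarefree d)
    (hV : ∀ v : HeightOneSpectrum (𝓞 ℚ), ((primesEquiv v : ℕ) : ℤ) ∣ d →
      W.HasGoodReductionAt v ∨ W.HasMultiplicativeReductionAt v)
    (Wd : WeierstrassCurve ℚ) [Wd.IsGloballyMinimal] (C : VariableChange ℚ)
    (hC : C • W.quadraticTwist (d : ℚ) = Wd) (hr : congruenceNumber D.f ≠ 0) :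
    ∃ u : ℚ, padicValRat p u = 0 ∧
      8 * Real.pi ^ 2 * (peterssonProduct (Gamma0 N) 2 D.f D.f).re / congruenceNumber D.f =
        (u : ℝ) * (Real.sqrt (-(d : ℝ)) * W.realPeriodRat * Wd.realPeriodRat) := by
  refine ⟨(D.deg : ℚ) / (congruenceNumber D.f * D.c ^ 2 * (Wd.baseChange ℝ).numRealComponents), ?_,
    D.eight_pi_sq_mul_peterssonProduct_re_div_congruenceNumber_eq hd hd4 hsq hV Wd C hC hr⟩
  have hval : padicValNat p (congruenceNumber D.f) = padicValNat p D.deg :=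
    hARS W N D hopt p (Fact.out) hpN
  have hn : (Wd.baseChange ℝ).numRealComponents = 1 ∨ (Wd.baseChange ℝ).numRealComponents = 2 := by
    unfold WeierstrassCurve.numRealComponents
    split_ifs <;> simp
  exact padicValRat_periodProductFactor_eq_zero hp2 D.deg_pos hr hpc hn hval

end Literature.NumberTheory.EllipticCurves.ModularForms.ModularParametrizationData

end
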